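import Summits.HodgeConjecture.HodgeConjecture.Theorems.MarkmanPartnerTransportPicardThreeK3SquaresSquareOfGenerator
import Literature.AlgebraicGeometry.HodgeTheory.HodgeTypeConjugation

/-!
# Route MarkmanPartnerTransport · crux `PicardThreeK3Squares` (stmt-HodgeConjecture-19652) — «CI-RING» (a):
# cycle-induced transcendental endomorphisms of `H²(S)` are closed under COMPOSITION (and form a non-unital
# `ℚ`-algebra)

Programme «KS-SELF» / «generated ⟹ all» of the cell hodge-nonav (planner p1 g38 OFFER «CI-RING», 14:50Z), K3 side,
pure correspondence calculus, NO Kuga–Satake. For a smooth projective complex SURFACE `S` and the Literature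
predicate `IsCycleInducedTranscendentalEndomorphism S hS t` (rational, type-preserving, kills `N¹(S)`, image
cup-orthogonal to `N¹(S)`, `t = [γ]_* = fst_*(snd^*(–) ∪ γ)` with `γ ∈ A²(S × S)`):

* `isCycleInducedTranscendentalEndomorphism_comp` / `_mul` — **closure under composition**:
  `[γ₁]_* ∘ [γ₂]_* = [γ₁ ∘ γ₂]_*` with `γ₁ ∘ γ₂ = π₁₃_*(π₁₂^*γ₂ ∪ π₂₃^*γ₁)` algebraic (the tree's composition of
  algebraic correspondences between surfaces `corrComp_surfaces_of_cup`, Fulton Prop. 16.1.1, with the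
  multiplicativity input `SquareOfGenerator.cupProduct_mem_algebraicClasses_tripleProduct`);
* `_zero`, `_add`, `_ratSmul`, `_neg`, `_sub`, `_sum`, `_pow_succ` — the cycle-induced transcendental endomorphisms
  are a non-unital `ℚ`-subalgebra of `End H²(S(ℂ); ℂ)` (the identity is NOT one: it does not kill `N¹`; the unit
  on `T(S)` is the transcendental projector, brick (b) of «CI-RING»).

Unconditional; no definition, no sorry, no named-fact hypothesis; general `hS : IsSmoothProjective 2 S` (the K3 case
of `_add` is `KugaSatakeSimilitude.isCycleInducedTranscendentalEndomorphism_add`). Prover seat hodge-nonav-20241-p1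
(gen 14), `--supports stmt-HodgeConjecture-19652`. Nothing here proves the crux or HC.

References: W. Fulton, *Intersection Theory* (1998), §16.1 Prop. 16.1.1; C. Voisin, *Hodge Theory I*, §11.1.2;
van Geemen–Schütt, Forum Math. Sigma 13 (2025) e2, §4.8.
-/

set_option linter.dupNamespace false

noncomputable section

namespace Summit.HodgeConjecture.HodgeConjecture.Theorems.MarkmanPartnerTransport.CycleInducedRing

open CategoryTheory MonoidalCategory CartesianMonoidalCategory
open Literature.AlgebraicGeometry Literature.AlgebraicGeometry.Motives Literature.AlgebraicGeometry.HodgeTheory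
open Literature.AlgebraicGeometry.Surfaces
open Literature.AlgebraicTopology.SingularHomology
open Summit.HodgeConjecture.HodgeConjecture.Theorems.MarkmanPartnerTransport.SquareOfGenerator

variable {S : SchemeOver ℂ} {hS : IsSmoothProjective 2 S}

/-- `Corr[μ, hS ; γ, y] = fst_*(snd^* y ∪ γ)` on `H²(S(ℂ); ℂ)`. Local notation only. -/
local notation3 (prettyPrint := false) "Corr[" μ ", " hS " ; " γ ", " y "]" =>
  complexGysin μ (IsSmoothProjective.tensor_holds hS hS) hS
    (SemiCartesianMonoidalCategory.fst _ _) (rfl : 2 * 1 + 2 * 2 + 2 * 2 = 2 * 1 + 2 * (2 + 2))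
    (cupProduct (rfl : 2 * 1 + 2 * 2 = 2 * 1 + 2 * 2)
      (complexBetti.map (SemiCartesianMonoidalCategory.snd _ _) (2 * 1) y) γ)

/-! ### Composition -/

/-- **Cycle-induced transcendental endomorphisms are closed under composition**: `[γ₁]_* ∘ [γ₂]_* = [γ₁ ∘ γ₂]_*`
with `γ₁ ∘ γ₂` an algebraic class on `S × S` (composition of algebraic correspondences between smooth projective
surfaces, `corrComp_surfaces_of_cup`); the composite is rational, type-preserving, kills `N¹(S)` and has image
cup-orthogonal to `N¹(S)` because the outer factor does. Unconditional. [cite: Fulton1998, §16.1 Prop. 16.1.1]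
[cite: GeemenSchutt2023, §4.8] -/
theorem isCycleInducedTranscendentalEndomorphism_comp {t₁ t₂ : complexBetti S (2 * 1) →ₗ[ℂ] complexBetti S (2 * 1)}
    (h₁ : IsCycleInducedTranscendentalEndomorphism S hS t₁) (h₂ : IsCycleInducedTranscendentalEndomorphism S hS t₂) :
    IsCycleInducedTranscendentalEndomorphism S hS (t₁ ∘ₗ t₂) := by
  obtain ⟨h1rat, h1typ, h1N, h1perp, γ₁, hγ₁, hγ₁t⟩ := h₁
  obtain ⟨h2rat, h2typ, h2N, -, γ₂, hγ₂, hγ₂t⟩ := h₂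
  obtain ⟨γ, hγ, hγt⟩ := corrComp_surfaces_of_cup complexOrientationFamily cupProduct_mem_algebraicClasses_tripleProduct
    S S S hS hS hS γ₁ hγ₁ γ₂ hγ₂
  refine ⟨fun y hy => ?_, fun i j y hy => ?_, fun d hd => ?_, fun y d hd => ?_, γ, hγ, fun y => ?_⟩
  · rw [LinearMap.comp_apply]
    exact h1rat _ (h2rat y hy)
  · rw [LinearMap.comp_apply]
    exact h1typ i j _ (h2typ i j y hy)
  · rw [LinearMap.comp_apply, h2N d hd, map_zero]
  · rw [LinearMap.comp_apply]
    exact h1perp _ d hd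
  · rw [LinearMap.comp_apply, hγ₂t y, hγ₁t, hγt y]

/-- **Closure under multiplication in `End H²(S(ℂ); ℂ)`** (`t₁ * t₂ = t₁ ∘ t₂`). [cite: Fulton1998, §16.1 Prop. 16.1.1] -/
theorem isCycleInducedTranscendentalEndomorphism_mul {t₁ t₂ : complexBetti S (2 * 1) →ₗ[ℂ] complexBetti S (2 * 1)}
    (h₁ : IsCycleInducedTranscendentalEndomorphism S hS t₁) (h₂ : IsCycleInducedTranscendentalEndomorphism S hS t₂) :
    IsCycleInducedTranscendentalEndomorphism S hS (t₁ * t₂) :=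
  isCycleInducedTranscendentalEndomorphism_comp h₁ h₂

/-! ### The non-unital `ℚ`-algebra structure -/

/-- **Zero is cycle-induced** (`[0]_* = 0`). [folklore] -/
theorem isCycleInducedTranscendentalEndomorphism_zero :
    IsCycleInducedTranscendentalEndomorphism S hS (0 : complexBetti S (2 * 1) →ₗ[ℂ] complexBetti S (2 * 1)) := by
  refine ⟨fun y _ => ?_, fun i j y _ => ?_, fun d _ => rfl, fun y d _ => ?_, 0, Submodule.zero_mem _, fun y => ?_⟩
  · rw [LinearMap.zero_apply]; exact IsRationalClass.zero
  · rw [LinearMap.zero_apply]; exact isOfHodgeType_zero_of_isSmoothProjective nonempty_hodgeModel_holds hS _ i j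
  · rw [LinearMap.zero_apply, LinearMap.map_zero₂]
  · rw [LinearMap.zero_apply, map_zero, map_zero]

/-- **Closure under addition** (`[γ₁]_* + [γ₂]_* = [γ₁ + γ₂]_*`), general smooth projective surface (the K3 spelling is
`KugaSatakeSimilitude.isCycleInducedTranscendentalEndomorphism_add`). [cite: Fulton1998, §16.1 Prop. 16.1.1] -/
theorem isCycleInducedTranscendentalEndomorphism_add {t₁ t₂ : complexBetti S (2 * 1) →ₗ[ℂ] complexBetti S (2 * 1)}
    (h₁ : IsCycleInducedTranscendentalEndomorphism S hS t₁) (h₂ : IsCycleInducedTranscendentalEndomorphism S hS t₂) :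
    IsCycleInducedTranscendentalEndomorphism S hS (t₁ + t₂) := by
  obtain ⟨h1rat, h1typ, h1N, h1perp, γ₁, hγ₁, hγ₁t⟩ := h₁
  obtain ⟨h2rat, h2typ, h2N, h2perp, γ₂, hγ₂, hγ₂t⟩ := h₂
  refine ⟨fun y hy => ?_, fun i j y hy => ?_, fun d hd => ?_, fun y d hd => ?_,
    γ₁ + γ₂, Submodule.add_mem _ hγ₁ hγ₂, fun y => ?_⟩
  · rw [LinearMap.add_apply]
    exact (h1rat y hy).add (h2rat y hy)
  · rw [LinearMap.add_apply]
    exact (h1typ i j y hy).add hS (h2typ i j y hy)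
  · rw [LinearMap.add_apply, h1N d hd, h2N d hd, add_zero]
  · rw [LinearMap.add_apply, LinearMap.map_add₂, h1perp y d hd, h2perp y d hd, add_zero]
  · rw [LinearMap.add_apply, hγ₁t y, hγ₂t y, map_add, map_add]

/-- **Closure under rational scalars** (`c · [γ]_* = [c · γ]_*`, `c ∈ ℚ`). [cite: Fulton1998, §16.1 Prop. 16.1.1] -/
theorem isCycleInducedTranscendentalEndomorphism_ratSmul {t : complexBetti S (2 * 1) →ₗ[ℂ] complexBetti S (2 * 1)}
    (h : IsCycleInducedTranscendentalEndomorphism S hS t) (c : ℚ) :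
    IsCycleInducedTranscendentalEndomorphism S hS ((c : ℂ) • t) := by
  obtain ⟨hrat, htyp, hN, hperp, γ, hγ, hγt⟩ := h
  refine ⟨fun y hy => ?_, fun i j y hy => ?_, fun d hd => ?_, fun y d hd => ?_,
    (c : ℂ) • γ, Submodule.smul_mem _ _ hγ, fun y => ?_⟩
  · rw [LinearMap.smul_apply]
    exact (hrat y hy).smul c
  · rw [LinearMap.smul_apply]
    exact (htyp i j y hy).smul _
  · rw [LinearMap.smul_apply, hN d hd, smul_zero]
  · rw [LinearMap.smul_apply, LinearMap.map_smul₂, hperp y d hd, smul_zero]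
  · rw [LinearMap.smul_apply, hγt y, map_smul, map_smul]

/-- **Closure under negation.** [folklore] -/
theorem isCycleInducedTranscendentalEndomorphism_neg {t : complexBetti S (2 * 1) →ₗ[ℂ] complexBetti S (2 * 1)}
    (h : IsCycleInducedTranscendentalEndomorphism S hS t) : IsCycleInducedTranscendentalEndomorphism S hS (-t) := by
  have h' := isCycleInducedTranscendentalEndomorphism_ratSmul h (-1)
  rwa [Rat.cast_neg, Rat.cast_one, neg_one_smul] at h'

/-- **Closure under subtraction.** [folklore] -/
theorem isCycleInducedTranscendentalEndomorphism_sub {t₁ t₂ : complexBetti S (2 * 1) →ₗ[ℂ] complexBetti S (2 * 1)}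
    (h₁ : IsCycleInducedTranscendentalEndomorphism S hS t₁) (h₂ : IsCycleInducedTranscendentalEndomorphism S hS t₂) :
    IsCycleInducedTranscendentalEndomorphism S hS (t₁ - t₂) := by
  rw [sub_eq_add_neg]
  exact isCycleInducedTranscendentalEndomorphism_add h₁ (isCycleInducedTranscendentalEndomorphism_neg h₂)

/-- **Closure under finite sums.** [folklore] -/
theorem isCycleInducedTranscendentalEndomorphism_sum {ι : Type*} (s : Finset ι)
    {t : ι → (complexBetti S (2 * 1) →ₗ[ℂ] complexBetti S (2 * 1))}
    (h : ∀ i ∈ s, IsCycleInducedTranscendentalEndomorphism S hS (t i)) :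
    IsCycleInducedTranscendentalEndomorphism S hS (∑ i ∈ s, t i) := by
  classical
  induction s using Finset.induction_on with
  | empty => rw [Finset.sum_empty]; exact isCycleInducedTranscendentalEndomorphism_zero
  | insert i s hi ih =>
    rw [Finset.sum_insert hi]
    exact isCycleInducedTranscendentalEndomorphism_add (h i (Finset.mem_insert_self i s))
      (ih fun j hj => h j (Finset.mem_insert_of_mem hj))

/-- **Closure under positive powers** (`t⁰ = id` is not transcendental: it does not kill `N¹`). [folklore] -/
theorem isCycleInducedTranscendentalEndomorphism_pow_succ {t : complexBetti S (2 * 1) →ₗ[ℂ] complexBetti S (2 * 1)}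
    (h : IsCycleInducedTranscendentalEndomorphism S hS t) (k : ℕ) :
    IsCycleInducedTranscendentalEndomorphism S hS (t ^ (k + 1)) := by
  induction k with
  | zero => rwa [zero_add, pow_one]
  | succ k ih => rw [pow_succ]; exact isCycleInducedTranscendentalEndomorphism_mul ih h

/-- **Closure under rational polynomials without constant term**: `Σ_{i<n} cᵢ tⁱ⁺¹` is cycle-induced. [folklore] -/
theorem isCycleInducedTranscendentalEndomorphism_sum_ratSmul_pow_succ
    {t : complexBetti S (2 * 1) →ₗ[ℂ] complexBetti S (2 * 1)} (h : IsCycleInducedTranscendentalEndomorphism S hS t)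
    {n : ℕ} (c : Fin n → ℚ) :
    IsCycleInducedTranscendentalEndomorphism S hS (∑ i : Fin n, (c i : ℂ) • t ^ ((i : ℕ) + 1)) :=
  isCycleInducedTranscendentalEndomorphism_sum _ fun i _ =>
    isCycleInducedTranscendentalEndomorphism_ratSmul (isCycleInducedTranscendentalEndomorphism_pow_succ h i) (c i)

end Summit.HodgeConjecture.HodgeConjecture.Theorems.MarkmanPartnerTransport.CycleInducedRing

end
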